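import Summits.Ventures.DiscreteObjects.UnitDistance.Sqrt2Sqrt3Plane
import Summits.Ventures.DiscreteObjects.UnitDistance.PlaneChromaticSummary

/-!
# Target (U) floor, field side: summary (cell `pub-namedobj`, seat udg g10)

Framing (verbatim for the cell): lottery ticket; floor = certified bounds/negative ranges.

One conjunction for the table: `χ(ℝ²) ∈ {5, 6, 7}` (udg g9, `PlaneChromaticSummary`), `χ(ℚ(√3,√11)²) = 4` (U1) and
`χ(ℚ(√2,√3)²) = 4` (U4) (this seat), and the census consequence: every unit-distance graph that is NOT 4-colourable —
in particular every 5-chromatic one and any hypothetical 6-chromatic witness of target (U) — has a vertex coordinate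
outside `ℚ(√3,√11)` and one outside `ℚ(√2,√3)` (indeed outside every `ℚ(√d : d ∈ S)` with the square classes of `S`
inside `⟨[2],[3]⟩`, `MultiquadraticTwoThree`).  Nothing here is literature.
-/

noncomputable section

namespace Summit.Ventures.DiscreteObjects.UnitDistance

open MoserLocal SimpleGraph

/-- FIELD-SIDE SUMMARY for target (U): the kernel range of `χ(ℝ²)`, the two field planes of chromatic number exactly `4`,
and the fact that every non-4-colourable unit-distance graph leaves both fields. -/
theorem fieldPlanes_summary :
    (planeUnitDistanceGraph.chromaticNumber = 5 ∨ planeUnitDistanceGraph.chromaticNumber = 6 ∨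
        planeUnitDistanceGraph.chromaticNumber = 7) ∧
      (planeUnitDistanceGraph.induce moserFieldPoints).chromaticNumber = 4 ∧
      (planeUnitDistanceGraph.induce sqrt2sqrt3Points).chromaticNumber = 4 ∧
      (∀ (V : Type) (G : SimpleGraph V) (p : V → EuclideanSpace ℝ (Fin 2)),
        IsUnitDistanceRealisation G p → ¬ G.Colorable 4 →
          (∃ v i, p v i ∉ moserCoordField) ∧ (∃ v i, p v i ∉ sqrt2sqrt3Field)) := by
  refine ⟨chromaticNumber_plane_cases, chromaticNumber_plane_moserCoordField, chromaticNumber_plane_sqrt2sqrt3, ?_⟩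
  intro V G p hp h4
  constructor
  · by_contra hall
    push Not at hall
    exact h4 (colorable_four_of_realisation_in_moserCoordField hp hall)
  · by_contra hall
    push Not at hall
    exact h4 (colorable_four_of_realisation_in_sqrt2sqrt3Field hp hall)

/-- In particular a witness of TARGET (U) (a 6-chromatic unit-distance graph) must use a coordinate outside `ℚ(√3,√11)`
and one outside `ℚ(√2,√3)`. -/
theorem sixChromatic_witness_leaves_fields {n : ℕ} {G : SimpleGraph (Fin n)} {p : Fin n → EuclideanSpace ℝ (Fin 2)}
    (hp : IsUnitDistanceRealisation G p) (h5 : ¬ G.Colorable 5) :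
    (∃ v i, p v i ∉ moserCoordField) ∧ (∃ v i, p v i ∉ sqrt2sqrt3Field) :=
  (fieldPlanes_summary.2.2.2) (Fin n) G p hp fun h4 => h5 (h4.mono (by norm_num))

end Summit.Ventures.DiscreteObjects.UnitDistance
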